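import Summits.AtomisticToContinuum.FouriersLaw.Theses.HonestZwanzig
import Summits.AtomisticToContinuum.FouriersLaw.Theorems.HonestZwanzigNetworkReductionPackage
import Summits.AtomisticToContinuum.FouriersLaw.Theorems.HonestZwanzigRobinCoercivityStubFeshbachIdentities
import Summits.AtomisticToContinuum.FouriersLaw.Theorems.HonestZwanzigOrthogonalOhmFixedNLimits
import Summits.AtomisticToContinuum.FouriersLaw.Theorems.HonestZwanzigFeshbachIdentitiesLaplacePositivity
import Summits.AtomisticToContinuum.FouriersLaw.Theorems.HonestZwanzigFeshbachIdentitiesSiteEnergy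
import Literature.MathematicalPhysics.KineticTheory.LangevinChainNESSProofs
import Summits.AtomisticToContinuum.FouriersLaw.Theorems.HonestZwanzigOrthogonalOhmBracketInduction
import Summits.AtomisticToContinuum.FouriersLaw.Theorems.HonestZwanzigOrthogonalOhmPoissonWeak
import Summits.AtomisticToContinuum.FouriersLaw.Theorems.HonestZwanzigOrthogonalOhmPoissonSmooth
import Summits.AtomisticToContinuum.FouriersLaw.Theorems.HonestZwanzigOrthogonalOhmDirichletBound

/-!
# HonestZwanzig / OrthogonalOhm — crux skeleton v6, line `Sketch` (lead c1, 2026-08-17)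

Crux item `stmt-AtomisticToContinuum-12693` (`HonestZwanzig.OrthogonalOhm`, sub-problem `FouriersLaw`).

Reshape of the registered skeleton v3 (stubs R2 `stub_bulkRegressionOhm`, R3′ `stub_clampedContactLocality`,
both open-problem class AND both carrying hidden fixed-`N` existence claims).  v4 separates the two kinds of
content of the crux at the skeleton level:

* FIXED `N` (provable, load-bearing for the crux itself — disprover `hiddenFixedN_remark`):
  - F = `G(0) ≻ 0` (the zero-frequency energy Gram matrix, the route's `G` at `s = 0`), now DERIVED
    (`g0PosDef_of_stubs`, now sorry-free) from the F-programme stubs F1a `stub_poissonWeak` (LANDED p143702),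
    F1b `stub_poissonSmooth` (LANDED p143814), F2 `stub_dirichletBound` (LANDED p143419/p143852), F3 `stub_bracketInduction`
    (LANDED p142061/p142501) — Poisson equation of the energy profile, hypoelliptic regularity, Dirichlet-form domination,
    bracket induction; independently the monolithic `stub_G0PosDef` (worker, Aux1 p141897 + Aux2 p142690 + main p144152).
    EVERY fixed-`N` ingredient of the crux is therefore PROVED; the remaining sorries are exactly U1 and U2.
  - `stub_fixedNLimits` (B, LANDED p140890): under the route item `FeshbachIdentities` (R0, PROVED:
    `Robin.stub_feshbachIdentities`) and `IsUnit (det G(0))`, every Schur pairing of admissible observables converges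
    as `s ↓ 0` to its value at `s = 0`: `schur_s(f,g) → schur_0(f,g)` (dominated convergence for `lap_s`, continuity
    of `Matrix.inv` at an invertible matrix).
* `N`-UNIFORM (the open core, ⊇ `HasBoundedResponse` by the disprover's `conductance_le_of_rowConstancy_backflow_bound`):
  - `stub_uniformBondResponse` (U1): one `k, C` for all `N`: ANY limit `ρ_b` of `schur_s(j_b, J)` has `|ρ_b| ≤ C` and
    `|ρ_b − k| ≤ ε` on bonds at distance `≥ R(ε)` from both ends (no existence claim inside; it is exactly the
    crux's bond clause minus existence).
  - `stub_uniformContactResponse` (U2): ANY limit `w` of a contact pairing `schur_s(p_y², J)`, `y ∈ {0, N−1}`, has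
    `|w| ≤ C` (the crux's contact clause minus existence).
* `orthogonalOhm_proof`: F + B (+ R0, symmetry of `G(0)` from the landed package) give existence with
  `ρ_b = schur_0(j_b, J)`, `w_y = schur_0(p_y², J)`; U1/U2 give the bounds; concludes the crux BY NAME.

The landed fixed-`N` identities of v1–v3 (R1 p97491, S1 p97059, S2 p97163, S3 p98711) and the kernel-form bridge
(`Lines/SketchKernelForm.lean`: U1 ⇐ N-uniform row bounds of the clamped memory kernel `𝔎_{bc} = schur_0(j_b,j_c)`,
by second-slot linearity at `s = 0`) remain the entry points for 𝔎-based attacks on U1 (cards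
korn-bakry-emery-one-phonon-rigidity, projected-thomson-locality, pair-field-feshbach-peel).
-/

namespace Summit.AtomisticToContinuum.FouriersLaw.Theorems.HonestZwanzig

open MeasureTheory Filter Topology
open scoped ContDiff
open Literature.MathematicalPhysics.KineticTheory.HeatConduction
open Summit.AtomisticToContinuum.FouriersLaw.Theorems.HonestZwanzig.NetworkReduction

/-! ### The F-programme: `G(0) ≻ 0` via the Poisson equation of an energy profile

For a profile `u = Σ ξ_x e_x` with mean `m = μ(u)` put `v(z) := ∫₀^∞ (P_t u(z) − m) dt` (exponential mixing).  Then
`ξᵀG(0)ξ = ∫₀^∞ corr(u,u) = ⟨u − m, v⟩_μ` (F1a), `v` has a smooth modification `w` solving `L w = −(u − m)`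
pointwise (hypoellipticity, F1b), the Dirichlet form at the left bath is dominated by the asymptotic variance,
`γT‖∂_{p_0}w‖²_μ ≤ ⟨u − m, w⟩_μ` (F2), and a solution invisible to the left bath forces `ξ = 0` (bracket induction,
F3, PROVED: `OrthogonalOhmLine.BracketInduction.bracketInduction`).  Hence `ξ ≠ 0 ⇒ ξᵀG(0)ξ > 0`
(`g0PosDef_of_stubs` below, replacing the former monolithic stub F `stub_G0PosDef`). -/

-- Stub F1a `stub_poissonWeak` LANDED: Theorems/HonestZwanzigOrthogonalOhmPoissonWeak.lean (p143702), imported above.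

-- Stub F1b `stub_poissonSmooth` LANDED: Theorems/HonestZwanzigOrthogonalOhmPoissonSmooth.lean (p143814), imported above.

-- Stub F2 `stub_dirichletBound` LANDED: Theorems/HonestZwanzigOrthogonalOhmDirichletBound{Aux1,}.lean (p143419, p143852), imported above.

-- Stub F3 `stub_bracketInduction` LANDED: Theorems/HonestZwanzigOrthogonalOhmBracketInduction{FD,}.lean (p142061, p142501,
-- 2026-08-17), imported above; `g0PosDef_of_stubs` cites it by its (unchanged) name.

/-- **`G(0) ≻ 0` from the F-programme** (formerly the monolithic stub F `stub_G0PosDef`): the zero-frequency energy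
Gram matrix `G(0)_{xy} = ∫₀^∞ corr(e_x,e_y)(t) dt` (the route's `G` at `s = 0`) is positive definite at every
`N ≥ 2`, composed from F1a, F1b, F2, F3. -/
theorem g0PosDef_of_stubs :
    ∀ ω₂ lam β γ : ℝ, 0 < ω₂ → 0 < lam → 0 < β → 0 < γ → ∀ T : ℝ, 0 < T → ∀ N : ℕ, 2 ≤ N → let P := Literature.MathematicalPhysics.KineticTheory.HeatConduction.pinnedChain ω₂ lam β γ; let X := Literature.MathematicalPhysics.KineticTheory.HeatConduction.PhaseSpace N; let μ : MeasureTheory.Measure X := P.gibbsMeasure N T; let corr : (X → ℝ) → (X → ℝ) → ℝ → ℝ := fun f g t => (∫ z, f z * (∫ y, g y ∂(P.transitionKernel N T T t.toNNReal z)) ∂μ) - (∫ z, f z ∂μ) * (∫ z, g z ∂μ); let lap : ℝ → (X → ℝ) → (X → ℝ) → ℝ := fun s f g => ∫ t in Set.Ioi (0 : ℝ), Real.exp (-(s * t)) * corr f g t; let e : Fin N → X → ℝ := fun x z => z.2 x ^ 2 / 2 + P.U (z.1 x) + ∑ j : Fin N, ((if j.val = x.val + 1 then P.V (z.1 j - z.1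 x) / 2 else 0) + (if x.val = j.val + 1 then P.V (z.1 x - z.1 j) / 2 else 0)); let G : ℝ → Matrix (Fin N) (Fin N) ℝ := fun s => Matrix.of fun x y => lap s (e x) (e y);
      ∀ ξ : Fin N → ℝ, ξ ≠ 0 → 0 < ∑ x : Fin N, ∑ y : Fin N, ξ x * G 0 x y * ξ y := by
  intro ω₂ lam β γ hω hl hβ hγ T hT N hN P X μ corr lap e G ξ hξ
  have hN0 : 0 < N := by omega
  -- the F-programme at this profile
  obtain ⟨hA, hmeas, hvar, hweak⟩ := stub_poissonWeak ω₂ lam β γ hω hl hβ hγ T hT N hN ξ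
  obtain ⟨w, hw, hwv, hAw, hLw⟩ := stub_poissonSmooth ω₂ lam β γ hω hl hβ hγ T hT N hN ξ hA hmeas hweak
  obtain ⟨-, hdir, hpos⟩ := stub_dirichletBound ω₂ lam β γ hω hl hβ hγ T hT N hN ξ w hw hAw hLw
  -- the quadratic form is the asymptotic variance of `u = Σ ξ_x e_x`
  set u : X → ℝ := fun z => ∑ x : Fin N, ξ x * e x z with hu
  set m : ℝ := ∫ z, u z ∂μ with hm
  have hnice := fun x => pinnedChain_splitSite_nice (ω₂ := ω₂) (lam := lam) (β := β) (γ := γ) (N := N) e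
    (fun x z => rfl) hω hl.le hβ.le x
  have hϑ0 : (0 : ℝ) < 1 / (8 * T) := by positivity
  have h2ϑ : 2 * (1 / (8 * T)) < 1 / T := by
    have h8 : (1 : ℝ) / (8 * T) = (1 / T) / 8 := by ring
    have hT' : (0 : ℝ) < 1 / T := by positivity
    rw [h8]; linarith
  have hquad : ∑ x : Fin N, ∑ y : Fin N, ξ x * G 0 x y * ξ y =
      ∫ t in Set.Ioi (0 : ℝ), ((∫ z, u z * (∫ y, u y ∂(P.transitionKernel N T T t.toNNReal z)) ∂μ) -
          (∫ z, u z ∂μ) * (∫ z, u z ∂μ)) := by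
    have h := pinnedChain_sum_lap_eq_lap_sum (ω₂ := ω₂) (lam := lam) (β := β) (γ := γ) (N := N) (T := T)
      hω hl.le hβ hγ hN0 hT hϑ0 h2ϑ (e := e) (fun x => (hnice x).1) (C := ((N : ℝ) + 2) / (1 / (8 * T)))
      (by positivity) (fun x y => (hnice x).2.2.2 _ hϑ0 y) ξ (s := 0) le_rfl
    have hG : ∀ x y, G 0 x y = ∫ t in Set.Ioi (0 : ℝ), Real.exp (-(0 * t)) * corr (e x) (e y) t := fun x y => rfl
    simp only [hG]
    simp only [zero_mul, neg_zero, Real.exp_zero, one_mul] at h ⊢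
    exact h
  -- if the quadratic form were `≤ 0`, the left-bath Dirichlet form of `w` would vanish
  by_contra hle
  push Not at hle
  have hσ : ∫ z, (u z - m) * w z ∂μ ≤ 0 := by
    have h1 : ∫ z, (u z - m) * w z ∂μ = ∫ z, (u z - m) * (fun z => ∫ t in Set.Ioi (0 : ℝ),
        ((∫ y, u y ∂(P.transitionKernel N T T t.toNNReal z)) - m)) z ∂μ := by
      refine MeasureTheory.integral_congr_ae ?_
      filter_upwards [hwv] with z hz
      rw [hz]
    rw [h1, ← hvar, ← hquad]
    exact hle
  have hp0 : ∀ z, Literature.MathematicalPhysics.KineticTheory.HeatConduction.partialP ⟨0, hN0⟩ w z = 0 := by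
    by_contra hex
    push Not at hex
    have h1 := hpos hex
    have h2 : γ * T * ∫ z, (Literature.MathematicalPhysics.KineticTheory.HeatConduction.partialP ⟨0, hN0⟩ w z) ^ 2 ∂μ ≤ 0 :=
      hdir.trans hσ
    have h3 : 0 < γ * T * ∫ z, (Literature.MathematicalPhysics.KineticTheory.HeatConduction.partialP ⟨0, hN0⟩ w z) ^ 2 ∂μ :=
      mul_pos (mul_pos hγ hT) h1
    linarith
  -- the bracket induction: a Poisson solution invisible to the left bath forces `ξ = 0`
  have hξ0 : ξ = 0 := stub_bracketInduction N ω₂ lam β γ T T hβ.le hN0 w (hw.differentiable (by simp)) e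
    (fun x z => rfl) ξ m hLw hp0
  exact hξ hξ0

-- Stub B `stub_fixedNLimits` LANDED: Theorems/HonestZwanzigOrthogonalOhmFixedNLimits.lean (p140890, 2026-08-17), imported above;
-- the composition below cites it by its (unchanged) name.

/-- **Stub U1** (`UniformBondResponse`, the N-uniform core ⊇ HasBoundedResponse): there are `k, C` such that for
every `ε > 0` there is `R` with: for all `N ≥ 2` and every bond `b`, ANY limit `ρ_b` of `schur_s(j_b, J)` as `s ↓ 0`
satisfies `|ρ_b| ≤ C`, and `|ρ_b − k| ≤ ε` when `b` is at distance `≥ R` from both ends.  (Exactly the crux's bond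
clause with the existence of the limit removed; = N-uniform bounds on the row sums of the clamped memory kernel.) -/
theorem stub_uniformBondResponse :
    ∀ ω₂ lam β γ : ℝ, 0 < ω₂ → 0 < lam → 0 < β → 0 < γ → ∀ T : ℝ, 0 < T → ∃ k C : ℝ, ∀ ε : ℝ, 0 < ε → ∃ R : ℕ, ∀ N : ℕ, 2 ≤ N → let P := Literature.MathematicalPhysics.KineticTheory.HeatConduction.pinnedChain ω₂ lam β γ; let X := Literature.MathematicalPhysics.KineticTheory.HeatConduction.PhaseSpace N; let μ : MeasureTheory.Measure X := P.gibbsMeasure N T; let corr : (X → ℝ) → (X → ℝ) → ℝ → ℝ := fun f g t => (∫ z, f z * (∫ y, g y ∂(P.transitionKernel N T T t.toNNReal z)) ∂μ) - (∫ z, f z ∂μ) * (∫ z, g z ∂μ); let lap : ℝ → (X → ℝ) → (X → ℝ) → ℝ := fun s f g => ∫ t in Set.Ioi (0 : ℝ), Real.exp (-(s * t)) * corr f g t; let e : Fin N → X → ℝ := fun x z => z.2 x ^ 2 / 2 + P.U (z.1 x) + ∑ j : Fin N, ((if j.val = x.val + 1 then P.V (z.1 j - z.1 x) / 2 else 0)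 + (if x.val = j.val + 1 then P.V (z.1 x - z.1 j) / 2 else 0)); let G : ℝ → Matrix (Fin N) (Fin N) ℝ := fun s => Matrix.of fun x y => lap s (e x) (e y); let schur : ℝ → (X → ℝ) → (X → ℝ) → ℝ := fun s f g => lap s f g - ∑ x : Fin N, ∑ y : Fin N, lap s f (e x) * (G s)⁻¹ x y * lap s (e y) g; let J : X → ℝ := fun z => ∑ i : Fin N, P.bondCurrent N i z;
      ∀ b : Fin N, b.val + 1 < N → ∀ ρ : ℝ,
        Filter.Tendsto (fun s => schur s (P.bondCurrent N b) J) (nhdsWithin (0 : ℝ) (Set.Ioi 0)) (nhds ρ) →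
          |ρ| ≤ C ∧ (R ≤ b.val → b.val + 2 + R ≤ N → |ρ - k| ≤ ε) := by
  sorry

/-- **Stub U2** (`UniformContactResponse`): there is `C` such that for all `N ≥ 2` and `y ∈ {0, N−1}`, ANY limit `w`
of the contact pairing `schur_s(p_y², J)` as `s ↓ 0` has `|w| ≤ C` (the crux's contact clause with existence removed;
by the landed contact identity S3 `w = −Σ_b ω_y(b)`, the summed clamped contact responses). -/
theorem stub_uniformContactResponse :
    ∀ ω₂ lam β γ : ℝ, 0 < ω₂ → 0 < lam → 0 < β → 0 < γ → ∀ T : ℝ, 0 < T → ∃ C : ℝ, ∀ N : ℕ, 2 ≤ N → let P := Literature.MathematicalPhysics.KineticTheory.HeatConduction.pinnedChain ω₂ lam β γ; let X := Literature.MathematicalPhysics.KineticTheory.HeatConduction.PhaseSpace N; let μ : MeasureTheory.Measure X := P.gibbsMeasure N T; let corr : (X → ℝ) → (X → ℝ) → ℝ → ℝ := fun f g t => (∫ z, f z * (∫ y, g y ∂(P.transitionKernel N T T t.toNNReal z)) ∂μ) - (∫ z, f z ∂μ) * (∫ z, g z ∂μ); let lap : ℝ → (X → ℝ) → (X → ℝ)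 → ℝ := fun s f g => ∫ t in Set.Ioi (0 : ℝ), Real.exp (-(s * t)) * corr f g t; let e : Fin N → X → ℝ := fun x z => z.2 x ^ 2 / 2 + P.U (z.1 x) + ∑ j : Fin N, ((if j.val = x.val + 1 then P.V (z.1 j - z.1 x) / 2 else 0) + (if x.val = j.val + 1 then P.V (z.1 x - z.1 j) / 2 else 0)); let G : ℝ → Matrix (Fin N) (Fin N) ℝ := fun s => Matrix.of fun x y => lap s (e x) (e y); let schur : ℝ → (X → ℝ) → (X → ℝ) → ℝ := fun s f g => lap s f g - ∑ x : Fin N, ∑ y : Fin N, lap s f (e x) * (G s)⁻¹ x y * lap s (e y) g; let J : X → ℝ := fun z => ∑ i : Fin N, P.bondCurrent N i z;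
      ∀ b : Fin N, (b.val = 0 ∨ b.val = N - 1) → ∀ w : ℝ,
        Filter.Tendsto (fun s => schur s (fun z => z.2 b ^ 2) J) (nhdsWithin (0 : ℝ) (Set.Ioi 0)) (nhds w) →
          |w| ≤ C := by
  sorry

/-- **OrthogonalOhm** (crux `stmt-AtomisticToContinuum-12693` of route `HonestZwanzig`), composed from the stubs of line
`Sketch`, skeleton v4: existence of the zero-frequency limits at each `N` from F + B (with the PROVED route item
`FeshbachIdentities` for symmetry/integrability), N-uniform bounds from U1 + U2. -/
theorem orthogonalOhm_proof : Summit.AtomisticToContinuum.FouriersLaw.Theses.HonestZwanzig.OrthogonalOhm := by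
  have h0 : Summit.AtomisticToContinuum.FouriersLaw.Theses.HonestZwanzig.FeshbachIdentities :=
    Robin.stub_feshbachIdentities  -- landed route item stmt-12697 (R0, p101386)
  have hF := g0PosDef_of_stubs
  have hB := stub_fixedNLimits h0
  have hU1 := stub_uniformBondResponse
  have hU2 := stub_uniformContactResponse
  intro ω₂ lam β γ hω hl hβ hγ T hT
  obtain ⟨k, C₁, hk⟩ := hU1 ω₂ lam β γ hω hl hβ hγ T hT
  obtain ⟨C₂, hC₂⟩ := hU2 ω₂ lam β γ hω hl hβ hγ T hT
  refine ⟨k, max C₁ C₂, fun ε hε => ?_⟩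
  obtain ⟨R, hR⟩ := hk ε hε
  refine ⟨R, fun N hN => ?_⟩
  intro P X μ corr lap e G schur J
  -- the Feshbach package at this `N` (second conjunct: integrability / time reversal / Kolmogorov)
  obtain ⟨-, hFI2, -, -⟩ := h0 ω₂ lam β γ hω hl hβ hγ T hT N hN
  -- symmetry of `G 0` (time reversal, even site energies) and positive definiteness (stub F) ⇒ invertible
  have hsymm : ∀ x y, G 0 x y = G 0 y x := fun x y =>
    pkg_G_symm (ω₂ := ω₂) (lam := lam) (β := β) (γ := γ) (N := N) (T := T)
      (Adm := fun f => Continuous f ∧ ∃ A : ℝ, ∀ z, |f z| ≤ A * Real.exp (P.hamiltonian N z / (8 * T)))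
      (corr := corr) (lap := lap) (cov := fun f g => (∫ z, f z * g z ∂μ) - (∫ z, f z ∂μ) * (∫ z, g z ∂μ)) (e := e)
      (fun f => Iff.rfl) (fun s f g => rfl) (fun x z => rfl) hFI2 hω hl.le hβ.le hT 0 x y
  have hpos : ∀ ξ : Fin N → ℝ, ξ ≠ 0 → 0 < ∑ x, ∑ y, ξ x * G 0 x y * ξ y :=
    hF ω₂ lam β γ hω hl hβ hγ T hT N hN
  have hPD : (G 0).PosDef := posDef_of_symm_of_pos (G 0) hsymm hpos
  have hdet : IsUnit (G 0).det := isUnit_iff_ne_zero.mpr hPD.det_pos.ne'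
  -- existence of the limits at this `N` (stub B)
  have hlim := hB ω₂ lam β γ hω hl hβ hγ T hT N hN hdet
  have hAdmJ : Continuous J ∧ ∃ A : ℝ, ∀ z, |J z| ≤ A * Real.exp (P.hamiltonian N z / (8 * T)) :=
    adm_totalCurrent (fun f => Continuous f ∧ ∃ A : ℝ, ∀ z, |f z| ≤ A * Real.exp (P.hamiltonian N z / (8 * T)))
      (fun f => Iff.rfl) hω hl.le hβ.le hT
  refine ⟨fun b hb => ?_, fun b hb => ?_⟩
  · -- bond clause
    have hAdmj : Continuous (P.bondCurrent N b) ∧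
        ∃ A : ℝ, ∀ z, |P.bondCurrent N b z| ≤ A * Real.exp (P.hamiltonian N z / (8 * T)) :=
      adm_bondCurrent (fun f => Continuous f ∧ ∃ A : ℝ, ∀ z, |f z| ≤ A * Real.exp (P.hamiltonian N z / (8 * T)))
        (fun f => Iff.rfl) hω hl.le hβ.le hT b
    have hρ : Tendsto (fun s => schur s (P.bondCurrent N b) J) (nhdsWithin (0 : ℝ) (Set.Ioi 0))
        (nhds (schur 0 (P.bondCurrent N b) J)) := hlim _ _ hAdmj hAdmJ
    obtain ⟨hC, hbulk⟩ := hR N hN b hb _ hρ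
    exact ⟨schur 0 (P.bondCurrent N b) J, hρ, hC.trans (le_max_left _ _), hbulk⟩
  · -- contact clause
    have hAdmp : Continuous (fun z : X => z.2 b ^ 2) ∧
        ∃ A : ℝ, ∀ z : X, |z.2 b ^ 2| ≤ A * Real.exp (P.hamiltonian N z / (8 * T)) :=
      adm_psq (fun f => Continuous f ∧ ∃ A : ℝ, ∀ z, |f z| ≤ A * Real.exp (P.hamiltonian N z / (8 * T)))
        (fun f => Iff.rfl) hω hl.le hβ.le hT b
    have hw : Tendsto (fun s => schur s (fun z => z.2 b ^ 2) J) (nhdsWithin (0 : ℝ) (Set.Ioi 0))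
        (nhds (schur 0 (fun z => z.2 b ^ 2) J)) := hlim _ _ hAdmp hAdmJ
    exact ⟨schur 0 (fun z => z.2 b ^ 2) J, hw, (hC₂ N hN b hb _ hw).trans (le_max_right _ _)⟩

end Summit.AtomisticToContinuum.FouriersLaw.Theorems.HonestZwanzig
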